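import Literature.AlgebraicGeometry.ModuliOfAbelianVarieties.SymplecticSimilitudeGroup
import Mathlib.RingTheory.Trace.Basic
import Mathlib.LinearAlgebra.Matrix.BilinearForm
import Mathlib.Data.Matrix.Composition
import HarnessLib

/-!
# Restriction of scalars into a symplectic similitude group: `GL_m(S) → GL_{m×κ}(R)` and the
# trace form `Tr_{S/R}(ᵗc(x) G y)` (the linear algebra of Hodge-type embeddings `Res_{S/R} GU(G) ↪ GSp(Tr G)`)

Topic `AlgebraicGeometry/ModuliOfAbelianVarieties`; namespace `Literature.AlgebraicGeometry.ModuliOfAbelianVarieties`.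
Definitions with bodies and theorems; no named fact, no instance, nothing asserted (net debt 0).  Generic layer
under the two embedding carriers of the I-1′ receptacle (cell hodgecm-mathlib): the symplectic embedding of the
twisted unitary datum `(U(H) × T₀(M)) ↪ GSp(W₀ ⊕ V_M, Tr_{M/ℚ}(…))` ([Deligne1979ShimuraVarieties] Prop. 2.3.10) and the
CM-algebra tori of the Siegel datum ([Deligne1971TravauxShimura] 4.18) are both «an `S`-linear group preserving an
`S`-valued (skew-)hermitian form `G` up to an `R`-multiplier, viewed `R`-linearly on `S^m` and measured by the
`R`-bilinear TRACE FORM `(x, y) ↦ Tr_{S/R}(ᵗc(x) G y)`», for a finite free commutative `R`-algebra `S` with an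
`R`-algebra endomorphism `c` (the involution) — [Milne2005ShimuraVarieties] §8 p. 81 «`ψ(x, y) = Tr_{B/ℚ}(…)`»,
[Shimura1998] §6.2 Thm. 4 p. 45 «`E(v(α), v(β)) = Tr_{K/ℚ}(ζ α β^ρ)`», [Deligne1971TravauxShimura] 4.9–4.11
(«restriction des scalaires … `Tr_{L/ℚ}`»).  This file does that linear algebra ONCE over an arbitrary commutative
base `R`, so that `R = ℚ`, `ℝ`, `𝔸_{ℚ,f}` are specialisations:

* `resMatrix b : Matrix m m S →+* Matrix (m × κ) (m × κ) R` — restriction of scalars along an `R`-basis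
  `b : Basis κ R S` (entrywise left-multiplication matrices ★ `Algebra.leftMulMatrix`, flattened by
  ★ `Matrix.compRingEquiv`); `resGL b : GL m S →* GL (m × κ) R`; `resBasis b` = the `R`-basis `eᵢ ⊗ b_k` of `S^m`,
  and `toMatrix_resBasis_mulVecLin`: the matrix of `x ↦ A·x` in that basis IS `resMatrix b A`.
* `traceForm c G : LinearMap.BilinForm R (m → S)`, `(x, y) ↦ Tr_{S/R}(ᵗc(x)·G·y)`; its Gram matrix
  `traceGram b c G` in `resBasis b` (`traceGram_apply`: entries `Tr_{S/R}(c(b_k) Gᵢⱼ b_l)`).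
* PROVED: `traceForm_mulVec_mulVec` — `ᵗc(A)·G·A = ν·G ⇒ Tr(ᵗc(Ax) G (Ay)) = ν·Tr(ᵗc(x) G y)`; hence
  **`isMultiplier_resGL`** / `resGL_mem_similitudeGroupOfForm`: `resGL b A` is a symplectic similitude of
  `traceGram b c G` with multiplier `ν` (★ `IsMultiplier`, ★ `similitudeGroupOfForm` of (σ1)).
* `conjRect P Q : GL n′ R →* GL n R` for a rectangular frame change `P Q = 1`, `Q P = 1`, and
  `isMultiplier_conjRect`: similitudes of `ᵗP E P` become similitudes of `E` (same multiplier).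

## References
* [Deligne1979ShimuraVarieties] P. Deligne, *Variétés de Shimura* (1979), Prop. 2.3.10 (PDF p. 32 of Milne's translation).
* [Deligne1971TravauxShimura] P. Deligne, *Travaux de Shimura* (1971), 4.9–4.11 p. 148, 4.18 p. 150.
* [Milne2005ShimuraVarieties] J. S. Milne, *Introduction to Shimura varieties* (2005), §6 p. 67, §8 p. 81.
* [Shimura1998] G. Shimura, *Abelian Varieties with Complex Multiplication and Modular Functions* (1998), §6.2 Thm. 4 p. 45.
-/

set_option autoImplicit false

noncomputable section

open Matrix

namespace Literature.AlgebraicGeometry.ModuliOfAbelianVarieties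

variable {R S : Type} [CommRing R] [CommRing S] [Algebra R S]
variable {κ : Type} [Fintype κ] [DecidableEq κ] {m : Type} [Fintype m] [DecidableEq m]

/-! ### §1. Restriction of scalars on matrices along a basis -/

section Res

variable (b : Module.Basis κ R S)

/-- **Restriction of scalars `M_m(S) → M_{m×κ}(R)` along the `R`-basis `b` of `S`**: replace every entry
`s ∈ S` by the matrix of `y ↦ s·y` in the basis `b` (★ `Algebra.leftMulMatrix`) and flatten the block matrix
(★ `Matrix.compRingEquiv`).  A ring homomorphism. [cite: Deligne1971TravauxShimura, 4.9 p. 147 («restriction des scalaires»)] -/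
def resMatrix : Matrix m m S →+* Matrix (m × κ) (m × κ) R :=
  (Matrix.compRingEquiv m κ R).toRingHom.comp (Algebra.leftMulMatrix b).toRingHom.mapMatrix

/-- Entries of the restriction of scalars: the `((i,k),(j,l))` entry is the `(k,l)` entry of the
left-multiplication matrix of `A i j`, i.e. the `k`-th `b`-coordinate of `A i j · b l`. [cite: Deligne1971TravauxShimura, 4.9 p. 147] -/
theorem resMatrix_apply (A : Matrix m m S) (i j : m) (k l : κ) :
    resMatrix b A (i, k) (j, l) = b.repr (A i j * b l) k := by
  rw [← Algebra.leftMulMatrix_eq_repr_mul]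
  rfl

/-- **Restriction of scalars on invertible matrices `GL_m(S) → GL_{m×κ}(R)`.** [cite: Deligne1971TravauxShimura, 4.9 p. 147] -/
def resGL : GL m S →* GL (m × κ) R :=
  Units.map (resMatrix (m := m) b).toMonoidHom

/-- Underlying matrix of `resGL`. [cite: Deligne1971TravauxShimura, 4.9 p. 147] -/
@[simp] theorem coe_resGL (A : GL m S) :
    ((resGL (m := m) b A : GL (m × κ) R) : Matrix (m × κ) (m × κ) R) = resMatrix b (A : Matrix m m S) := rfl

/-- **The `R`-basis `eᵢ ⊗ b_k` of `S^m`** (`(i, k) ↦ Pi.single i (b k)`), indexed by `m × κ` (the basis in which restriction of scalars is read). [cite: Deligne1971TravauxShimura, 4.9 p. 147] -/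
def resBasis : Module.Basis (m × κ) R (m → S) :=
  (Pi.basis fun _ : m => b).reindex (Equiv.sigmaEquivProd m κ)

omit [Fintype κ] [DecidableEq κ] in
/-- `resBasis b (i, k) = Pi.single i (b k)`. [cite: Deligne1971TravauxShimura, 4.9 p. 147] -/
@[simp] theorem resBasis_apply (i : m) (k : κ) : resBasis (m := m) b (i, k) = Pi.single i (b k) := by
  rw [resBasis, Module.Basis.reindex_apply]
  simp [Pi.basis_apply]

omit [Fintype κ] [DecidableEq κ] [DecidableEq m] in
/-- Coordinates in `resBasis`: the `(i, k)` coordinate of `x` is the `k`-th `b`-coordinate of `x i`. [cite: Deligne1971TravauxShimura, 4.9 p. 147] -/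
@[simp] theorem resBasis_repr (x : m → S) (i : m) (k : κ) :
    (resBasis (m := m) b).repr x (i, k) = b.repr (x i) k := by
  rw [resBasis, Module.Basis.repr_reindex_apply]
  simp [Pi.basis_repr]

omit [DecidableEq m] in
/-- `(A·eⱼs)ᵢ = Aᵢⱼ·s`. [folklore] -/
private theorem mulVec_single_apply (A : Matrix m m S) (j : m) (s : S) (i : m) [DecidableEq m] :
    (A *ᵥ Pi.single j s) i = A i j * s := by
  simp [Matrix.mulVec, dotProduct, Pi.single_apply]

/-- **The matrix of `x ↦ A·x` (`S`-linear, viewed `R`-linearly) in the basis `eᵢ ⊗ b_k` is `resMatrix b A`.**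
[cite: Deligne1971TravauxShimura, 4.9 p. 147] -/
theorem toMatrix_resBasis_mulVecLin (A : Matrix m m S) :
    LinearMap.toMatrix (resBasis (m := m) b) (resBasis b) ((Matrix.mulVecLin A).restrictScalars R) =
      resMatrix b A := by
  ext ⟨i, k⟩ ⟨j, l⟩
  rw [LinearMap.toMatrix_apply, resBasis_apply, resBasis_repr, resMatrix_apply, LinearMap.coe_restrictScalars,
    Matrix.mulVecLin_apply, mulVec_single_apply]

end Res

/-! ### §2. The trace form `Tr_{S/R}(ᵗc(x) G y)` and its multipliers -/

section TraceForm

variable (c : S →ₐ[R] S) (G : Matrix m m S)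

/-- **The trace form `ψ_G(x, y) = Tr_{S/R}(ᵗc(x)·G·y) = Tr_{S/R}(Σᵢⱼ c(xᵢ) Gᵢⱼ yⱼ)`** on `S^m`, an `R`-bilinear form
(`c` an `R`-algebra endomorphism of `S`, e.g. the involution of a CM algebra; `G` the Gram matrix of a
`c`-sesquilinear form). [cite: Milne2005ShimuraVarieties, §8 p. 81] [cite: Shimura1998, §6.2 Thm. 4 (3) p. 44] -/
def traceForm : LinearMap.BilinForm R (m → S) :=
  LinearMap.mk₂ R (fun x y => Algebra.trace R S (dotProduct (fun i => c (x i)) (G *ᵥ y)))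
    (fun x x' y => by
      have h : (fun i => c ((x + x') i)) = (fun i => c (x i)) + fun i => c (x' i) := by
        funext i; simp [map_add]
      rw [h, add_dotProduct, map_add])
    (fun r x y => by
      have h : (fun i => c ((r • x) i)) = r • fun i => c (x i) := by
        funext i; simp [map_smul]
      rw [h, smul_dotProduct, map_smul])
    (fun x y y' => by rw [Matrix.mulVec_add, dotProduct_add, map_add])
    (fun r x y => by rw [Matrix.mulVec_smul, dotProduct_smul, map_smul])

omit [DecidableEq m] in
/-- Unfolding of the trace form. [cite: Milne2005ShimuraVarieties, §8 p. 81] -/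
theorem traceForm_apply (x y : m → S) :
    traceForm c G x y = Algebra.trace R S (dotProduct (fun i => c (x i)) (G *ᵥ y)) := rfl

omit [DecidableEq m] in
/-- `c` applied to `A·x` is `c(A)·c(x)`. [folklore] -/
private theorem map_mulVec_eq (A : Matrix m m S) (x : m → S) :
    (fun i => c ((A *ᵥ x) i)) = A.map c *ᵥ fun i => c (x i) := by
  funext i
  simp [Matrix.mulVec, dotProduct, map_sum, map_mul]

omit [DecidableEq m] in
/-- `(A·v)·w = v·(ᵗA·w)`. [folklore] -/
private theorem mulVec_dotProduct_eq (A : Matrix m m S) (v w : m → S) : (A *ᵥ v) ⬝ᵥ w = v ⬝ᵥ (Aᵀ *ᵥ w) := by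
  rw [dotProduct_comm, dotProduct_mulVec, Matrix.mulVec_transpose, dotProduct_comm]

omit [DecidableEq m] in
/-- **Multipliers of the trace form**: if `ᵗc(A)·G·A = ν·G` (`A` preserves the sesquilinear form `G` up to the
scalar `ν ∈ R`) then `ψ_G(Ax, Ay) = ν·ψ_G(x, y)`. [cite: Milne2005ShimuraVarieties, §6 p. 67 and §8 p. 81]
[cite: Deligne1971TravauxShimura, 4.11 p. 148] -/
theorem traceForm_mulVec_mulVec {A : Matrix m m S} {ν : R} (hA : (A.map c)ᵀ * G * A = algebraMap R S ν • G)
    (x y : m → S) : traceForm c G (A *ᵥ x) (A *ᵥ y) = ν • traceForm c G x y := by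
  rw [traceForm_apply, traceForm_apply, map_mulVec_eq, mulVec_dotProduct_eq, Matrix.mulVec_mulVec,
    Matrix.mulVec_mulVec, hA, Matrix.smul_mulVec, dotProduct_smul, algebraMap_smul, map_smul]

variable (b : Module.Basis κ R S)

/-- **The Gram matrix of the trace form in the basis `eᵢ ⊗ b_k`** (`BilinForm.toMatrix`). [cite: Milne2005ShimuraVarieties, §8 p. 81] -/
def traceGram : Matrix (m × κ) (m × κ) R :=
  LinearMap.BilinForm.toMatrix (resBasis (m := m) b) (traceForm c G)

/-- Entries of the Gram matrix: `Tr_{S/R}(c(b_k)·G_{ij}·b_l)`. [cite: Shimura1998, §6.2 Thm. 4 (3) p. 44] -/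
theorem traceGram_apply (p q : m × κ) :
    traceGram c G b p q = Algebra.trace R S (c (b p.2) * G p.1 q.1 * b q.2) := by
  obtain ⟨i, k⟩ := p
  obtain ⟨j, l⟩ := q
  rw [traceGram, LinearMap.BilinForm.toMatrix_apply, resBasis_apply, resBasis_apply, traceForm_apply]
  congr 1
  have hc : (fun i' => c (Pi.single (M := fun _ : m => S) i (b k) i')) = Pi.single i (c (b k)) := by
    funext i'
    by_cases h : i' = i
    · subst h; simp
    · simp [h]
  rw [hc]
  simp [dotProduct, Matrix.mulVec, Pi.single_apply, mul_assoc]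

/-- **Restriction of scalars lands in the similitude group of the trace form**: if `ᵗc(A)·G·A = ν·G` with
`ν ∈ Rˣ` then `resGL b A` has multiplier `ν` for `traceGram c G b`. [cite: Deligne1971TravauxShimura, 4.9–4.11 p. 148]
[cite: Milne2005ShimuraVarieties, §8 p. 81] -/
theorem isMultiplier_resGL {A : GL m S} {ν : Rˣ}
    (hA : ((A : Matrix m m S).map c)ᵀ * G * A = algebraMap R S (ν : R) • G) :
    IsMultiplier (traceGram c G b) (resGL b A) ν := by
  rw [isMultiplier_iff, coe_resGL, ← toMatrix_resBasis_mulVecLin, traceGram, ← LinearMap.BilinForm.toMatrix_comp]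
  have h : (traceForm c G).comp ((Matrix.mulVecLin (A : Matrix m m S)).restrictScalars R)
      ((Matrix.mulVecLin (A : Matrix m m S)).restrictScalars R) = (ν : R) • traceForm c G := by
    refine LinearMap.ext fun x => LinearMap.ext fun y => ?_
    rw [LinearMap.BilinForm.comp_apply, LinearMap.smul_apply, LinearMap.smul_apply]
    exact traceForm_mulVec_mulVec c G hA x y
  rw [h, LinearEquiv.map_smul]

/-- `resGL b A ∈ GSp(traceGram)` for `A` preserving `G` up to a unit multiplier. [cite: Deligne1971TravauxShimura, 4.9–4.11 p. 148] -/
theorem resGL_mem_similitudeGroupOfForm {A : GL m S}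
    (hA : ∃ ν : Rˣ, ((A : Matrix m m S).map c)ᵀ * G * A = algebraMap R S (ν : R) • G) :
    resGL b A ∈ similitudeGroupOfForm (traceGram c G b) := by
  obtain ⟨ν, hν⟩ := hA
  exact ⟨ν, isMultiplier_resGL c G b hν⟩

end TraceForm

/-! ### §3. Rectangular change of frame -/

section Frame

variable {n n' : Type} [Fintype n] [DecidableEq n] [Fintype n'] [DecidableEq n']

/-- **Conjugation by a rectangular frame**: for `P : n × n′`, `Q : n′ × n` with `P Q = 1`, `Q P = 1` (a change of
basis between index types of the same cardinality), `g ↦ P g Q : GL_{n′}(R) → GL_n(R)`. [cite: Milne2005ShimuraVarieties, §6 p. 67] -/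
def conjRect (P : Matrix n n' R) (Q : Matrix n' n R) (hPQ : P * Q = 1) (hQP : Q * P = 1) : GL n' R →* GL n R where
  toFun g :=
    { val := P * (g : Matrix n' n' R) * Q
      inv := P * ((g⁻¹ : GL n' R) : Matrix n' n' R) * Q
      val_inv := by
        calc P * (g : Matrix n' n' R) * Q * (P * ((g⁻¹ : GL n' R) : Matrix n' n' R) * Q)
            = P * ((g : Matrix n' n' R) * (Q * P) * ((g⁻¹ : GL n' R) : Matrix n' n' R)) * Q := by
              simp only [Matrix.mul_assoc]
          _ = 1 := by rw [hQP, Matrix.mul_one, ← Units.val_mul, mul_inv_cancel, Units.val_one, Matrix.mul_one, hPQ]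
      inv_val := by
        calc P * ((g⁻¹ : GL n' R) : Matrix n' n' R) * Q * (P * (g : Matrix n' n' R) * Q)
            = P * (((g⁻¹ : GL n' R) : Matrix n' n' R) * (Q * P) * (g : Matrix n' n' R)) * Q := by
              simp only [Matrix.mul_assoc]
          _ = 1 := by rw [hQP, Matrix.mul_one, ← Units.val_mul, inv_mul_cancel, Units.val_one, Matrix.mul_one, hPQ] }
  map_one' := by
    ext1
    change P * ((1 : GL n' R) : Matrix n' n' R) * Q = 1
    rw [Units.val_one, Matrix.mul_one, hPQ]
  map_mul' g h := by
    ext1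
    change P * ((g * h : GL n' R) : Matrix n' n' R) * Q = P * (g : Matrix n' n' R) * Q * (P * (h : Matrix n' n' R) * Q)
    rw [Units.val_mul]
    calc P * ((g : Matrix n' n' R) * (h : Matrix n' n' R)) * Q
        = P * ((g : Matrix n' n' R) * (Q * P) * (h : Matrix n' n' R)) * Q := by rw [hQP, Matrix.mul_one]
      _ = P * (g : Matrix n' n' R) * Q * (P * (h : Matrix n' n' R) * Q) := by simp only [Matrix.mul_assoc]

/-- Underlying matrix of `conjRect`. [cite: Milne2005ShimuraVarieties, §6 p. 67] -/
@[simp] theorem coe_conjRect (P : Matrix n n' R) (Q : Matrix n' n R) (hPQ : P * Q = 1) (hQP : Q * P = 1)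
    (g : GL n' R) : ((conjRect P Q hPQ hQP g : GL n R) : Matrix n n R) = P * (g : Matrix n' n' R) * Q := rfl

/-- **Change of frame for similitudes**: if `g` is a similitude of the transported form `ᵗP·E·P` with multiplier
`ν`, then `P g Q` is a similitude of `E` with the same multiplier. [cite: Milne2005ShimuraVarieties, §6 p. 67] -/
theorem isMultiplier_conjRect {E : Matrix n n R} (P : Matrix n n' R) (Q : Matrix n' n R) (hPQ : P * Q = 1)
    (hQP : Q * P = 1) {g : GL n' R} {ν : Rˣ} (hg : IsMultiplier (Pᵀ * E * P) g ν) :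
    IsMultiplier E (conjRect P Q hPQ hQP g) ν := by
  rw [isMultiplier_iff] at hg ⊢
  rw [coe_conjRect, Matrix.transpose_mul, Matrix.transpose_mul]
  have hQt : Pᵀ * Qᵀ = 1 := by rw [← Matrix.transpose_mul, hQP, Matrix.transpose_one]
  have hQt' : Qᵀ * Pᵀ = 1 := by rw [← Matrix.transpose_mul, hPQ, Matrix.transpose_one]
  calc Qᵀ * ((g : Matrix n' n' R)ᵀ * Pᵀ) * E * (P * (g : Matrix n' n' R) * Q)
      = Qᵀ * ((g : Matrix n' n' R)ᵀ * (Pᵀ * E * P) * (g : Matrix n' n' R)) * Q := by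
        simp only [Matrix.mul_assoc]
    _ = Qᵀ * ((ν : R) • (Pᵀ * E * P)) * Q := by rw [hg]
    _ = (ν : R) • ((Qᵀ * Pᵀ) * E * (P * Q)) := by
        rw [Matrix.mul_smul, Matrix.smul_mul]; simp only [Matrix.mul_assoc]
    _ = (ν : R) • E := by rw [hQt', hPQ, Matrix.one_mul, Matrix.mul_one]

/-- `P g Q ∈ GSp(E)` whenever `g ∈ GSp(ᵗP E P)`. [cite: Milne2005ShimuraVarieties, §6 p. 67] -/
theorem conjRect_mem_similitudeGroupOfForm {E : Matrix n n R} (P : Matrix n n' R) (Q : Matrix n' n R)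
    (hPQ : P * Q = 1) (hQP : Q * P = 1) {g : GL n' R} (hg : g ∈ similitudeGroupOfForm (Pᵀ * E * P)) :
    conjRect P Q hPQ hQP g ∈ similitudeGroupOfForm E := by
  obtain ⟨ν, hν⟩ := hg
  exact ⟨ν, isMultiplier_conjRect P Q hPQ hQP hν⟩

end Frame

end Literature.AlgebraicGeometry.ModuliOfAbelianVarieties

end
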